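import Summits.NavierStokesRegularity.NavierStokesRegularity.Theorems.TypeIQuarterGateLorentzUpgradeIffQuarterLaw
import Summits.NavierStokesRegularity.NavierStokesRegularity.Theorems.TypeIQuarterGateLorentzLogOctave
import HarnessLib

/-!
# `TypeIQuarterGate`: the quarter law bounds the octave cube up to one logarithm (23726 → 23843's SD shape)

By name: `QuarterLawTypeI` (stmt-NavierStokesRegularity-23726) — now kernel-equivalent to
`LorentzUpgradeTypeI` (p818591) — gives along every Type-I blow-up of the frame, at late times `t`, every
centre `a` and every radius `ℓ` with `√(T−t) ≤ C ℓ`: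

  `∫_{B(a,ℓ)} ‖u(t)‖³ ≤ |B(0,1)| + 3 M′ · log(C ℓ / √(T−t))`

(`quarterLaw_logOctaveBudget`; `ballCube_le_log_of_rate_of_weakL3`, p818268).  This is the deciding stub SD
(slice-wise octave budget, line `slice_budget` of `ScarEnvelopeTypeI`, stmt-23843) UP TO EXACTLY ONE
LOGARITHM — Barker–Prange's `log(ℓ²/(T−t))` shape (CMP 2021; survey arXiv:2211.16215 p. 14), which SD's
docstring records as sharp IN ORDER for the mean over octaves.  So the K1-class (23726 = 24108 = 23970)
reaches 23843's budget modulo the logarithm and no further by this road.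

HONEST FRAMING: a conditional bound along a HYPOTHETICAL Type-I blow-up under the OPEN statement
`QuarterLawTypeI`; nothing about Navier–Stokes regularity or blow-up is claimed. [folklore]
-/

-- the problem directory repeats the summit name (`NavierStokesRegularity/NavierStokesRegularity`)
set_option linter.dupNamespace false

noncomputable section

open Set Filter MeasureTheory Topology Metric
open scoped ENNReal NNReal

namespace Summit.NavierStokesRegularity.NavierStokesRegularity.Theorems

namespace LorentzOfEnvelope

open Literature.Analysis.FluidPDE Literature.Analysis.FunctionSpaces
open Summit.NavierStokesRegularity.NavierStokesRegularity.Theses.TypeIQuarterGate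

/-- **`QuarterLawTypeI` ⟹ the log-octave budget.** Under `QuarterLawTypeI`, along every maximal smooth
Leray–Hopf solution from a rapidly decaying datum with the Type-I rate at `T` there are `C, M′ > 0` and
`t₀ < T` such that for `t ∈ (t₀,T)`, every `a` and every `ℓ > 0` with `√(T−t) ≤ C ℓ`:
`∫_{B(a,ℓ)} ‖u(t)‖³ ≤ |B(0,1)| + 3 M′ log(Cℓ/√(T−t))`. [folklore] -/
theorem quarterLaw_logOctaveBudget (hK : QuarterLawTypeI) :
    ∀ (ν T : ℝ), 0 < ν → 0 < T →
      ∀ (u : ℝ → EuclideanSpace ℝ (Fin 3) → EuclideanSpace ℝ (Fin 3))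
        (p : ℝ → EuclideanSpace ℝ (Fin 3) → ℝ),
        IsMaximalSmoothSolution ν 0 u p T → IsLerayHopfOn T ν 0 (u 0) u →
        HasRapidSpatialDecay (u 0) → IsTypeIBlowup u T →
        ∃ C M' t₀ : ℝ, 0 < C ∧ 0 ≤ M' ∧ t₀ < T ∧ ∀ t ∈ Ioo t₀ T,
          ∀ (a : EuclideanSpace ℝ (Fin 3)) (ℓ : ℝ), 0 < ℓ → Real.sqrt (T - t) ≤ C * ℓ →
            ∫⁻ x in ball a ℓ, ‖u t x‖ₑ ^ (3 : ℝ) ≤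
              volume (ball (0 : EuclideanSpace ℝ (Fin 3)) 1) +
                ENNReal.ofReal (3 * M' * Real.log (C * ℓ / Real.sqrt (T - t))) := by
  intro ν T hν hT u p hmax hLH hdec hI
  obtain ⟨M', hM'⟩ := lorentzUpgradeTypeI_of_quarterLawTypeI hK ν T hν hT u p hmax hLH hdec hI
  obtain ⟨CI, hCI⟩ := hI
  obtain ⟨t₁, ht₁T, hrate⟩ := mem_nhdsLT_iff_exists_Ioo_subset.1 hCI
  set C : ℝ := max CI 1 with hC_def
  have hC : 0 < C := lt_of_lt_of_le one_pos (le_max_right _ _)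
  -- `M' ≥ 0` may be assumed (replace by `max M' 0`)
  refine ⟨C, max M' 0, max t₁ 0, hC, le_max_right _ _, max_lt ht₁T hT, ?_⟩
  intro t ht a ℓ hℓ hsC
  have ht0 : 0 ≤ t := (le_max_right _ _).trans ht.1.le
  have ht₁ : t₁ < t := lt_of_le_of_lt (le_max_left _ _) ht.1
  have hs : 0 < Real.sqrt (T - t) := Real.sqrt_pos.2 (by linarith [ht.2])
  have hsup : ∀ x, ‖u t x‖ ≤ C / Real.sqrt (T - t) := fun x =>
    (hrate ⟨ht₁, ht.2⟩ x).trans (div_le_div_of_nonneg_right (le_max_left _ _) hs.le)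
  have hW : eWeakLpPow (u t) 3 volume ≤ ENNReal.ofReal (max M' 0) :=
    (hM' t ⟨ht0, ht.2⟩).trans (ENNReal.ofReal_le_ofReal (le_max_left _ _))
  have hmeas : AEStronglyMeasurable (u t) volume := (hLH.memLp t ⟨ht0, ht.2.le⟩).1
  exact ballCube_le_log_of_rate_of_weakL3 hmeas hs hℓ hsC hsup hW a

end LorentzOfEnvelope

end Summit.NavierStokesRegularity.NavierStokesRegularity.Theorems
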